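import Summits.BirchSwinnertonDyer.BirchSwinnertonDyer.Theorems.ThetaPartnerAtTwoSignedMainConjectureCMTwoRankZeroFlatTwistCRT
import Summits.BirchSwinnertonDyer.BirchSwinnertonDyer.Theorems.ThetaPartnerAtTwoSignedMainConjectureCMTwoRankZeroFlatTwist
import HarnessLib

/-!
# Route `ThetaPartnerAtTwo`, crux K2r0P `SignedMainConjectureCMTwoRankZeroOfPub` (stmt-BirchSwinnertonDyer-24945),
# line `rankzero` v14, stub (μ♭)_A: ELEMENTARY TWIST TRANSPORT OF FLAT AT `p = 2` for every SQUARE-FREE real quadratic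
# twist — the dilation set `S_m` of a square-free modulus and the plus-symbol congruence (C) for `A = W^{(d)}`

Cell `bsd-wall`, width seat `bsd-wall-tp2-p2-w3` (g2). THEOREMS ONLY (no `def`, no named fact, no `sorry`); helper `--supports`
the crux; sequel of `…FlatTwistHecke` (prime modulus, p614468), `…FlatTwistCRT` (recursion step, p617382) and `…FlatTwist`
(the prime twist, p615935). Nothing about any particular curve is asserted; BSD is not proved by any of this.

* §4 `exists_dilationSet_prime` — the prime case of `…FlatTwistHecke` packaged: `T_ℓ(y) ≡ ∑_{t∈S_ℓ} I(ty) (mod 2ℤ)` with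
  `S_ℓ = {1, ℓ²}` (`a_ℓ` even) or `{1, ℓ, ℓ²}` (`a_ℓ` odd); **`exists_dilationSet_twistedSum`** — for every SQUARE-FREE `m` prime to
  `N` (with integral Hecke eigenvalues `a_ℓ(g)` at the primes `ℓ ∣ m`) there is a non-empty finite set `S_m` of divisors of `m²` with
  `∑_{u mod m} (u/m)(2[x + u/m]⁺_g − 2[u/m]⁺_g) ≡ ∑_{t∈S_m} 2([tx]⁺_g − [0]⁺_g) (mod 2ℤ)` for every `x` with `den x` prime to `N`
  (induction on the primes of `m`, step `S_{ℓm} = S_ℓ·S_m` by `exists_int_twistedSum_mul`).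
* §5 **`exists_plusSymbol_congruence_twist_squarefree`** — for `W/ℚ` good at `2` with `2 ∣ a₂(W)`, `d > 0` SQUARE-FREE,
  `d ≡ 1 (mod 4)`, `(d, N_W) = 1`, `A` a globally minimal model of `W^{(d)}`, newforms `f_W`, `f_A`, some `[x]⁺_{f_A} ≠ 0`, granted
  `hmod` and the period unit `h2`: the OldClassFlat congruence (C) «`2([b/4^k]⁺_{f_A} − [0]⁺_{f_A}) − ∑_{t∈S} 2([tb/4^k]⁺_{f_W} −
  [0]⁺_{f_W}) ∈ 2ℤ`» with `S = S_{|d|}` (odd divisors of `d²`) — Birch's lemma with its period constant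
  (`exists_ratPlusSymbol_twist_eq_sum_and_sq`), `|c|₂ = 1` (`FlatTwist.norm_birchConst_eq_one`: Pal + `h2`), and §4 for `f_W`.
  The transport / FLAT / anchor statements for square-free `d` follow in `…FlatTwistSquarefree`.

References: B. Mazur, J. Tate, J. Teitelbaum, Invent. Math. 84 (1986) §I.4 (4.2), §I.8 [MazurTateTeitelbaum1986Invent]; V. Pal,
Proc. AMS 140 (2012) Thm. 3.2 [Pal2012]; G. Shimura (1971) Prop. 3.64 [Shimura1971]; K. Ireland, M. Rosen, GTM 84, Prop. 5.2.2
[IrelandRosen1990]; M. Emerton, R. Pollack, T. Weston, Invent. Math. 163 (2006) Lemma 4.4.4 [EmertonPollackWeston2006].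
-/

set_option autoImplicit false
-- the Theorems namespace of this sub repeats the summit name by design (D-0017 nested layout)
set_option linter.dupNamespace false

noncomputable section

open scoped Classical MatrixGroups ModularForm NumberField NumberTheorySymbols

open NumberField IsDedekindDomain Rat.HeightOneSpectrum CongruenceSubgroup
  Literature.NumberTheory.EllipticCurves Literature.NumberTheory.GaloisRepresentations
  WeierstrassCurve Literature.NumberTheory.EllipticCurves.ModularForms Literature.NumberTheory.EllipticCurves.Rank1Residual
  Literature.NumberTheory.EllipticCurves.Rank1Residual.Typed
  Summit.BirchSwinnertonDyer.Rank1Residual Summit.BirchSwinnertonDyer.Rank1Residual.Supersingular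

namespace Summit.BirchSwinnertonDyer.BirchSwinnertonDyer.Theorems.FlatTwist

/-! ## §4. The dilation set of a square-free modulus -/

section Dilation

variable {N : ℕ} [NeZero N] (g : CuspForm (Gamma0 N) 2)

omit [NeZero N] in
/-- The raw Legendre weight `b ↦ (b/ℓ)` on `ℤ/ℓ` (`ℓ` prime) is `≡ 𝟙_{b ≠ 0} (mod 2)`. [cite: IrelandRosen1990, Prop. 5.2.2] -/
theorem exists_jacobiSym_val_eq_indicator_add {ℓ : ℕ} [NeZero ℓ] (hp : ℓ.Prime) (b : ZMod ℓ) :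
    ∃ t : ℤ, J((b.val : ℤ) | ℓ) = (if b = 0 then 0 else 1) + 2 * t := by
  by_cases hb : b = 0
  · subst hb
    refine ⟨0, ?_⟩
    rw [ZMod.val_zero, Nat.cast_zero, jacobiSym.zero_left hp.one_lt]
    simp
  · rw [if_neg hb]
    haveI : Fact ℓ.Prime := ⟨hp⟩
    have hval : b.val ≠ 0 := fun h ↦ hb ((ZMod.val_eq_zero b).mp h)
    have hcop : (b.val : ℤ).gcd ℓ = 1 := by
      rw [Int.gcd_natCast_natCast]
      exact (Nat.coprime_of_lt_prime hval (ZMod.val_lt b) hp).symm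
    rcases jacobiSym.eq_one_or_neg_one hcop with h | h
    · exact ⟨0, by rw [h]; ring⟩
    · exact ⟨-1, by rw [h]; ring⟩

/-- **The dilation set of a PRIME modulus** (`…FlatTwistHecke` packaged): for a prime `ℓ ∤ N` with `a_ℓ(g) = a ∈ ℤ` there is
`S ⊆ {1, ℓ, ℓ²}` (namely `{1, ℓ²}` if `a` is even, `{1, ℓ, ℓ²}` if odd), non-empty, of divisors of `ℓ²`, with
`∑_{u mod ℓ} (u/ℓ)(2[y + u/ℓ]⁺ − 2[u/ℓ]⁺) ≡ ∑_{t∈S} 2([ty]⁺ − [0]⁺) (mod 2ℤ)` for every `y` with `den y` prime to `N`.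
[cite: MazurTateTeitelbaum1986Invent, §I.4 (4.2) and §I.8] -/
theorem exists_dilationSet_prime (hg : IsNewform0 g) (hQ : coeffField g = ⊥) {ℓ : ℕ} [NeZero ℓ] (hp : ℓ.Prime)
    (hℓN : ¬ ℓ ∣ N) {a : ℤ} (ha : cuspCoeff g ℓ = a) :
    ∃ S : Finset ℕ, S.Nonempty ∧ (∀ t ∈ S, t ∣ ℓ ^ 2) ∧
      ∀ y : ℚ, y.den.Coprime N → ∃ z : ℤ,
        ∑ u : ZMod ℓ, (J((u.val : ℤ) | ℓ) : ℚ) *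
            (2 * ratPlusSymbol g (y + (u.val : ℚ) / ℓ) - 2 * ratPlusSymbol g ((u.val : ℚ) / ℓ)) =
          ∑ t ∈ S, 2 * (ratPlusSymbol g ((t : ℚ) * y) - ratPlusSymbol g 0) + 2 * z := by
  have hreal : ∀ n, (cuspCoeff g n).im = 0 := cuspCoeff_im_eq_zero_of_coeffField_eq_bot hQ
  have h1 : (1 : ℕ) ≠ ℓ ^ 2 := fun h ↦ hp.one_lt.ne' (by nlinarith [hp.one_lt])
  have h1' : (1 : ℕ) ≠ ℓ := hp.one_lt.ne
  have hll : ℓ ≠ ℓ ^ 2 := fun h ↦ by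
    have : ℓ * 1 = ℓ * ℓ := by rw [mul_one, ← sq]; exact h
    exact hp.one_lt.ne (Nat.eq_of_mul_eq_mul_left hp.pos this)
  refine ⟨if Even a then ({1, ℓ ^ 2} : Finset ℕ) else {1, ℓ, ℓ ^ 2}, by split_ifs <;> simp, ?_, ?_⟩
  · intro t ht
    split_ifs at ht
    · simp only [Finset.mem_insert, Finset.mem_singleton] at ht
      rcases ht with rfl | rfl
      · exact one_dvd _
      · exact dvd_rfl
    · simp only [Finset.mem_insert, Finset.mem_singleton] at ht
      rcases ht with rfl | rfl | rfl
      · exact one_dvd _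
      · exact dvd_pow_self _ two_ne_zero
      · exact dvd_rfl
  intro y hy
  obtain ⟨z₁, hz₁⟩ := exists_int_twistedSum_eq g hg hQ hp hℓN ha (fun b ↦ J((b.val : ℤ) | ℓ))
    (exists_jacobiSym_val_eq_indicator_add hp) hy
  obtain ⟨v, hv⟩ := SignedMuAtTwo.exists_two_mul_ratPlusSymbol_sub_eq_intCast g hreal (coprime_den_natCast_mul hy ℓ)
  have hsq : ((ℓ ^ 2 : ℕ) : ℚ) * y = (ℓ : ℚ) ^ 2 * y := by push_cast; ring
  by_cases hae : Even a
  · rw [if_pos hae]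
    obtain ⟨r, hr⟩ := hae
    refine ⟨z₁ + r * v, ?_⟩
    rw [hz₁, Finset.sum_pair h1, Nat.cast_one, one_mul, hsq, hv]
    have hr' : (a : ℚ) = r + r := by exact_mod_cast hr
    push_cast
    linear_combination (v : ℚ) * hr'
  · rw [if_neg hae]
    have hao : Odd a := Int.not_even_iff_odd.mp hae
    obtain ⟨r, hr⟩ := hao
    refine ⟨z₁ + r * v, ?_⟩
    rw [hz₁, Finset.sum_insert (by simp [h1', h1]), Finset.sum_pair hll, Nat.cast_one, one_mul, hsq, hv]
    have hr' : (a : ℚ) = 2 * r + 1 := by exact_mod_cast hr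
    push_cast
    linear_combination (v : ℚ) * hr'

/-- Products of divisors of `a²` and of `b²` determine their factors when `(a, b) = 1`, `a ≠ 0`. [folklore] -/
theorem mul_injOn_divisors_sq {a b : ℕ} (hab : a.Coprime b) (ha : a ≠ 0) {Sa Sb : Finset ℕ}
    (hSa : ∀ t ∈ Sa, t ∣ a ^ 2) (hSb : ∀ t ∈ Sb, t ∣ b ^ 2) :
    Set.InjOn (fun q : ℕ × ℕ ↦ q.1 * q.2) ↑(Sa ×ˢ Sb) := by
  rintro ⟨t₁, u₁⟩ hq ⟨t₂, u₂⟩ hq' h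
  simp only [Finset.coe_product, Set.mem_prod, Finset.mem_coe] at hq hq'
  simp only at h
  have hab2 : (a ^ 2).Coprime (b ^ 2) := Nat.Coprime.pow 2 2 hab
  have c12 : t₁.Coprime u₂ := Nat.Coprime.coprime_dvd_left (hSa _ hq.1) (Nat.Coprime.coprime_dvd_right (hSb _ hq'.2) hab2)
  have c21 : t₂.Coprime u₁ := Nat.Coprime.coprime_dvd_left (hSa _ hq'.1) (Nat.Coprime.coprime_dvd_right (hSb _ hq.2) hab2)
  have d12 : t₁ ∣ t₂ := c12.dvd_of_dvd_mul_right (h ▸ Dvd.intro u₁ rfl)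
  have d21 : t₂ ∣ t₁ := c21.dvd_of_dvd_mul_right (h.symm ▸ Dvd.intro u₂ rfl)
  have ht : t₁ = t₂ := Nat.dvd_antisymm d12 d21
  subst ht
  have ht0 : t₁ ≠ 0 := by
    rintro rfl
    have h0 := hSa 0 hq.1
    rw [zero_dvd_iff] at h0
    exact pow_ne_zero 2 ha h0
  have hu : u₁ = u₂ := Nat.eq_of_mul_eq_mul_left (Nat.pos_of_ne_zero ht0) h
  rw [hu]

/-- **THE DILATION SET OF A SQUARE-FREE MODULUS.** For a normalised newform `g` of level `N` with rational coefficients, every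
SQUARE-FREE `m` prime to `N` whose prime divisors `ℓ` have integral Hecke eigenvalue `a_ℓ(g)` admits a non-empty finite set `S_m`
of divisors of `m²` with `∑_{u mod m} (u/m)(2[x + u/m]⁺_g − 2[u/m]⁺_g) = ∑_{t∈S_m} 2([tx]⁺_g − [0]⁺_g) + 2ℤ` for every `x` with
`den x` prime to `N` — induction on the primes of `m` (`induction_on_primes`): `S_1 = {1}`, `S_ℓ` from `exists_dilationSet_prime`,
`S_{ℓm} = S_ℓ·S_m` from the recursion `exists_int_twistedSum_mul`. [cite: MazurTateTeitelbaum1986Invent, §I.4 (4.2) and §I.8]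
[cite: EmertonPollackWeston2006, Lemma 4.4.4] -/
theorem exists_dilationSet_twistedSum (hg : IsNewform0 g) (hQ : coeffField g = ⊥) :
    ∀ (m : ℕ) [NeZero m], Squarefree m → m.Coprime N →
      (∀ ℓ : ℕ, ℓ.Prime → ℓ ∣ m → ∃ a : ℤ, cuspCoeff g ℓ = a) →
      ∃ S : Finset ℕ, S.Nonempty ∧ (∀ t ∈ S, t ∣ m ^ 2) ∧
        ∀ x : ℚ, x.den.Coprime N → ∃ z : ℤ,
          ∑ u : ZMod m, (J((u.val : ℤ) | m) : ℚ) *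
              (2 * ratPlusSymbol g (x + (u.val : ℚ) / m) - 2 * ratPlusSymbol g ((u.val : ℚ) / m)) =
            ∑ t ∈ S, 2 * (ratPlusSymbol g ((t : ℚ) * x) - ratPlusSymbol g 0) + 2 * z := by
  refine induction_on_primes ?_ ?_ ?_
  · intro _ hsq
    exact absurd hsq (by simp)
  · intro _ _ _ _
    refine ⟨{1}, by simp, by simp, fun x _ ↦ ⟨0, ?_⟩⟩
    have hv : ∀ u : ZMod 1, u.val = 0 := fun u ↦ Nat.lt_one_iff.mp (ZMod.val_lt u)
    rw [Fintype.sum_unique, Finset.sum_singleton]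
    simp only [hv, Nat.cast_zero, zero_div, add_zero, jacobiSym.one_right, Int.cast_one, one_mul, Nat.cast_one,
      Int.cast_zero, mul_zero]
    ring
  · intro p a hp ih _ hsq hcop hint
    obtain ⟨hpa, -, hsqa⟩ := Nat.squarefree_mul_iff.mp hsq
    have hpa0 : p * a ≠ 0 := NeZero.ne (p * a)
    haveI : NeZero a := ⟨fun h ↦ hpa0 (by rw [h, mul_zero])⟩
    haveI : NeZero p := ⟨hp.ne_zero⟩
    have hpN : p.Coprime N := Nat.Coprime.coprime_mul_right hcop
    have haN : a.Coprime N := Nat.Coprime.coprime_mul_left hcop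
    have hpN' : ¬ p ∣ N := fun h ↦ hp.one_lt.ne' (Nat.Coprime.eq_one_of_dvd hpN h)
    obtain ⟨ap, hap⟩ := hint p hp (dvd_mul_right p a)
    obtain ⟨Sp, hSp, hSpd, hQp⟩ := exists_dilationSet_prime g hg hQ hp hpN' hap
    obtain ⟨Sa, hSa, hSad, hQa⟩ := ih hsqa haN (fun ℓ hℓ hℓa ↦ hint ℓ hℓ (dvd_mul_of_dvd_right hℓa p))
    refine ⟨(Sp ×ˢ Sa).image (fun q ↦ q.1 * q.2), (hSp.product hSa).image _, ?_, ?_⟩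
    · intro t ht
      obtain ⟨q, hq, rfl⟩ := Finset.mem_image.mp ht
      obtain ⟨hq1, hq2⟩ := Finset.mem_product.mp hq
      rw [mul_pow]
      exact mul_dvd_mul (hSpd _ hq1) (hSad _ hq2)
    · intro x hx
      obtain ⟨z, hz⟩ := exists_int_twistedSum_mul g hQ hpa haN Sp Sa hSpd hQp hQa hx
      refine ⟨z, ?_⟩
      rw [hz, Finset.sum_image (mul_injOn_divisors_sq hpa hp.ne_zero hSpd hSad)]

end Dilation

/-! ## §5. The plus-symbol congruence (C) for a square-free real quadratic twist -/

section Congruence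

variable (W : WeierstrassCurve ℚ) [W.IsElliptic] [W.IsGloballyMinimal] {d : ℤ} {A : WeierstrassCurve ℚ}
  [A.IsElliptic] [A.IsGloballyMinimal] [NeZero (W.conductorNorm ℤ)] [NeZero (A.conductorNorm ℤ)]
  {fW : CuspForm (Gamma0 (W.conductorNorm ℤ)) 2} {fA : CuspForm (Gamma0 (A.conductorNorm ℤ)) 2}

/-- **THE PLUS-SYMBOL CONGRUENCE (C) FOR A SQUARE-FREE REAL TWIST.** Let `W/ℚ` be globally minimal, good at `2` with `2 ∣ a₂(W)`,
`d > 0` SQUARE-FREE with `d ≡ 1 (mod 4)` and `(d, N_W) = 1`, `A` a globally minimal model of `W^{(d)}`, `f_W`, `f_A` the newforms,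
and assume some `[x]⁺_{f_A} ≠ 0`. Grant modularity (`hmod`) and the period unit at `2` (`h2`). THEN there is a non-empty finite set
`S` of odd naturals (divisors of `d²`) with, for all `k ≥ 1`, `b` odd:
`2([b/4^k]⁺_{f_A} − [0]⁺_{f_A}) − ∑_{t∈S} 2([tb/4^k]⁺_{f_W} − [0]⁺_{f_W}) ∈ 2ℤ` — the hypothesis `hcong` of the old-class descent
`SignedMuAtTwo.exists_odd_of_plusSymbol_congruence`. Birch's lemma with its period constant, `|c|₂ = 1` from Pal + `h2`, and the
dilation set of §4 for `f_W`. [cite: MazurTateTeitelbaum1986Invent, §I.4 (4.2) and §I.8] [cite: Pal2012, Thm. 3.2 (case d > 0)]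
[cite: Shimura1971, Prop. 3.64] -/
theorem exists_plusSymbol_congruence_twist_squarefree (hmod : exists_isNewformOf)
    (h2 : Literature.NumberTheory.EllipticCurves.realPeriodRat_eq_unit_mul_plusPeriod_two)
    (hss : GoodSS W 2) (hd : 0 < d) (hd4 : d % 4 = 1) (hsq : Squarefree d)
    (hcop : IsCoprime d (W.conductorNorm ℤ : ℤ)) {C : VariableChange ℚ} (hA : C • W.quadraticTwist (d : ℚ) = A)
    (hfW : IsNewformOf W fW) (hfA : IsNewformOf A fA) (hnz : ∃ x : ℚ, ratPlusSymbol fA x ≠ 0) :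
    ∃ S : Finset ℕ, S.Nonempty ∧ (∀ t ∈ S, Odd t) ∧
      ∀ k : ℕ, 1 ≤ k → ∀ b : ℤ, Odd b → ∃ z : ℤ,
        2 * (ratPlusSymbol fA ((b : ℚ) / 4 ^ k) - ratPlusSymbol fA 0) -
          ∑ t ∈ S, 2 * (ratPlusSymbol fW ((((t : ℤ) * b : ℤ) : ℚ) / 4 ^ k) - ratPlusSymbol fW 0) = 2 * z := by
  haveI : Fact (Nat.Prime 2) := ⟨Nat.prime_two⟩
  set m : ℕ := d.natAbs with hm_def
  have hd0 : d ≠ 0 := hd.ne'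
  haveI : NeZero m := ⟨Int.natAbs_ne_zero.mpr hd0⟩
  have hmodd : Odd m := Int.natAbs_odd.mpr (Int.odd_iff.mpr (by omega))
  have hsqm : Squarefree m := Int.squarefree_natAbs.mpr hsq
  have hmN : m.Coprime (W.conductorNorm ℤ) := by
    have h := Int.isCoprime_iff_gcd_eq_one.mp hcop
    unfold Int.gcd at h
    simpa using h
  -- Birch's lemma with its period constant
  obtain ⟨χ, hχ⟩ := exists_mulChar_int_eq_jacobiSym m
  obtain ⟨c, hc, hcsq⟩ := exists_ratPlusSymbol_twist_eq_sum_and_sq W hmod hd hd4 hsq hcop hA hfW hfA hχ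
  -- reduction data
  have h2d : ¬ (2 : ℤ) ∣ d := by omega
  obtain ⟨hgoodA, haA⟩ := hasGoodReductionAtPrime_twist_and_frobeniusTrace_eq W 2 hmod hd4 hsq hcop hA hss.1 h2d
  have hssA : GoodSS A 2 := ⟨hgoodA, by rw [haA]; exact dvd_mul_of_dvd_right hss.2 _⟩
  have h2NW : ¬ 2 ∣ W.conductorNorm ℤ := not_dvd_level_of_isNewformOf hfW hss.1
  have h2NA : ¬ 2 ∣ A.conductorNorm ℤ := not_dvd_level_of_isNewformOf hfA hgoodA
  have hrealW : ∀ n, (cuspCoeff fW n).im = 0 := cuspCoeff_im_eq_zero_of_coeffField_eq_bot hfW.coeffField_eq_bot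
  have hrealA : ∀ n, (cuspCoeff fA n).im = 0 := cuspCoeff_im_eq_zero_of_coeffField_eq_bot hfA.coeffField_eq_bot
  -- integral Hecke eigenvalues of `f_W` at the primes of `m` (all good for `W`)
  have hint : ∀ ℓ : ℕ, ℓ.Prime → ℓ ∣ m → ∃ a : ℤ, cuspCoeff fW ℓ = a := by
    intro ℓ hℓ hℓm
    haveI : Fact ℓ.Prime := ⟨hℓ⟩
    have hℓN : ¬ ℓ ∣ W.conductorNorm ℤ := fun h ↦
      hℓ.one_lt.ne' (Nat.Coprime.eq_one_of_dvd (Nat.Coprime.coprime_dvd_left hℓm hmN) h)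
    have hgoodℓ : W.HasGoodReductionAtPrime ℓ := by
      by_contra h
      exact hℓN ((W.dvd_conductorNorm_iff_not_hasGoodReductionAtPrime ℓ).mpr h)
    exact ⟨W.frobeniusTrace ℓ, cuspCoeff_eq_frobeniusTrace_of_isNewformOf_holds hfW hgoodℓ⟩
  -- the dilation set of `m` for `f_W`
  obtain ⟨S, hS, hSd, hQS⟩ := exists_dilationSet_twistedSum fW hfW.1 hfW.coeffField_eq_bot m hsqm hmN hint
  -- the period constant is a `2`-adic unit (Pal + `h2` at `W` and `A`)
  obtain ⟨uW, huW1, huW⟩ := h2 W hss.1 (P2.irr_two_of_goodSS_two W hss) fW hfW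
  obtain ⟨uA, huA1, huA⟩ := h2 A hssA.1 (P2.irr_two_of_goodSS_two A hssA) fA hfA
  have hV : ∀ v : HeightOneSpectrum (𝓞 ℚ), ((primesEquiv v : ℕ) : ℤ) ∣ d →
      W.HasGoodReductionAt v ∨ W.HasMultiplicativeReductionAt v := by
    intro v hvd
    left
    refine hasGoodReductionAt_of_not_dvd_conductorNorm W v fun hvN ↦ ?_
    have hℓ : ((primesEquiv v : ℕ)).Prime := (primesEquiv v).2
    have hu := Int.isUnit_iff_natAbs_eq.mp (hcop.isUnit_of_dvd' hvd (Int.natCast_dvd_natCast.mpr hvN))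
    rw [Int.natAbs_natCast] at hu
    exact hℓ.one_lt.ne' hu
  have hPal := W.sqrt_mul_realPeriodRat_eq_of_twist_of_pos_of_squarefree hd hd4 hsq hV A C hA
  have hcu : ‖(c : ℚ_[2])‖ = 1 :=
    norm_birchConst_eq_one hd A.realPeriodRat_pos_holds (hcsq hnz) huW huA hPal huW1 huA1
  refine ⟨S, hS, fun t ht ↦ (hmodd.pow (n := 2)).of_dvd_nat (hSd t ht), ?_⟩
  intro k hk b hb
  set x : ℚ := (b : ℚ) / 4 ^ k with hx_def
  have h4pow : ((4 : ℚ) ^ k) = 2 ^ (2 * k) := by rw [pow_mul]; norm_num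
  have hxW : x.den.Coprime (W.conductorNorm ℤ) := by
    rw [hx_def, h4pow]; exact SignedMuAtTwo.coprime_den_div_two_pow h2NW b (2 * k)
  have hxA : x.den.Coprime (A.conductorNorm ℤ) := by
    rw [hx_def, h4pow]; exact SignedMuAtTwo.coprime_den_div_two_pow h2NA b (2 * k)
  -- the dilation congruence for `f_W` at `x`, and the integers `I_W(tx)`
  obtain ⟨z₁, hz₁⟩ := hQS x hxW
  choose i hi using fun t : ℕ ↦
    SignedMuAtTwo.exists_two_mul_ratPlusSymbol_sub_eq_intCast fW hrealW (coprime_den_natCast_mul hxW t)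
  obtain ⟨mA, hmA⟩ := SignedMuAtTwo.exists_two_mul_ratPlusSymbol_sub_eq_intCast fA hrealA hxA
  -- Birch at `x` and at `0`: `M_A(x) = c · T_m(x)`
  have hχcast : ∀ u : ZMod m, ((χ.ringHomComp (Int.castRingHom ℚ)) u : ℚ) = ((J((u.val : ℤ) | m) : ℤ) : ℚ) := fun u ↦ by
    rw [MulChar.ringHomComp_apply, hχ]; rfl
  have hMA : (mA : ℚ) = c * ((∑ t ∈ S, i t : ℤ) + 2 * z₁) := by
    have hx1 := hc x
    have hx0 := hc 0
    simp only [zero_add] at hx0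
    have h2 : 2 * (c * ∑ u : ZMod m, (χ.ringHomComp (Int.castRingHom ℚ)) u * ratPlusSymbol fW (x + (u.val : ℚ) / m) -
        c * ∑ u : ZMod m, (χ.ringHomComp (Int.castRingHom ℚ)) u * ratPlusSymbol fW ((u.val : ℚ) / m)) =
        c * ∑ u : ZMod m, (J((u.val : ℤ) | m) : ℚ) *
          (2 * ratPlusSymbol fW (x + (u.val : ℚ) / m) - 2 * ratPlusSymbol fW ((u.val : ℚ) / m)) := by
      calc _ = c * (2 * (∑ u : ZMod m, (χ.ringHomComp (Int.castRingHom ℚ)) u * ratPlusSymbol fW (x + (u.val : ℚ) / m) -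
            ∑ u : ZMod m, (χ.ringHomComp (Int.castRingHom ℚ)) u * ratPlusSymbol fW ((u.val : ℚ) / m))) := by ring
        _ = _ := by
          congr 1
          rw [← Finset.sum_sub_distrib, Finset.mul_sum]
          refine Finset.sum_congr rfl fun u _ ↦ ?_
          rw [hχcast]
          ring
    have hsumI : (∑ t ∈ S, 2 * (ratPlusSymbol fW ((t : ℚ) * x) - ratPlusSymbol fW 0)) = ((∑ t ∈ S, i t : ℤ) : ℚ) := by
      push_cast
      exact Finset.sum_congr rfl fun t _ ↦ hi t
    rw [← hmA, hx1, hx0, h2, hz₁, hsumI]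
  obtain ⟨z₂, hz₂⟩ := exists_sub_eq_two_mul_of_eq_unit_mul (J := (∑ t ∈ S, i t) + 2 * z₁) hcu
    (by rw [hMA]; push_cast; ring)
  refine ⟨z₂ + z₁, ?_⟩
  have hsum : ∑ t ∈ S, 2 * (ratPlusSymbol fW ((((t : ℤ) * b : ℤ) : ℚ) / 4 ^ k) - ratPlusSymbol fW 0) =
      ((∑ t ∈ S, i t : ℤ) : ℚ) := by
    push_cast
    refine Finset.sum_congr rfl fun t _ ↦ ?_
    rw [← hi t, hx_def]
    ring_nf
  rw [hsum, hmA]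
  have hz₂' : (mA : ℚ) - ((∑ t ∈ S, i t : ℤ) + 2 * z₁ : ℤ) = 2 * z₂ := by exact_mod_cast hz₂
  push_cast at hz₂' ⊢
  linear_combination hz₂'

end Congruence

end Summit.BirchSwinnertonDyer.BirchSwinnertonDyer.Theorems.FlatTwist

end
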